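import Summits.AtomisticToContinuum.HydrodynamicLimit.Theorems.InformationPercolationEngineChaosClosesEulerShellInitial
import Summits.AtomisticToContinuum.HydrodynamicLimit.Theorems.InformationPercolationEngineChaosClosesEulerShellL1
import Literature.Analysis.FluidPDE.MVIntegrandsMeasurability
import Literature.Analysis.FluidPDE.MVRelativeEnergyPointwiseBounds
import HarnessLib

/-!
# BF18 shell for functions (crux `ChaosClosesEuler`, stmt-AtomisticToContinuum-15141, line `Sketch`,
# stub `stub_bf18Shell`) — helper: the clamped relative energy is small near the data

WHAT. `relEnergyZ_small_near_data` (registered form `stub_bf18ShellInit`): fix an equation of state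
with Gibbs' relation, thermodynamic stability, a genuine temperature inversion `ϑ(ρ, E)` and positive
internal energy; a compact set `K ⊂ (0,∞)²` of reference states `(r, Θ)`; data bounded by `M`; and an
entropy window `[a, b]` containing `s(ρ, ϑ)` on the `δK`-box around `K`. Then for every `κ > 0` there is
`η > 0` such that every state `(ρ, E, m)` (density, INTERNAL energy, momentum) whose density, momentum
and TOTAL energy are `η`-close to those of the data,
`|ρ − r| ≤ η`, `‖m − rU‖ ≤ η`, `|½|m|²/ρ + E − (½ r|U|² + r e(r,Θ))| ≤ η`,
lies in the open quadrant `ρ, E > 0` and has clamped relative energy `ℰ_Z(ρ, E, m | r, Θ, U) ≤ κ`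
(`Z = clamp a b`).

WHY. The shell's Grönwall argument starts from `F(0) = ∫ ℰ_Z(V(0,·) | data(0,·)) dx`, which the
hypothesis (H5) of the shell — uniform closeness of the conserved fields to the classical data at time
`0` — must make small. Near the data the clamp is inactive and `ℰ_Z = ½|m − ρU|²/ρ + R(ρ, ϑ | r, Θ)`
(`relEnergyZ_eq`); the kinetic part is `O(η²)` (`abs_kinetic_sub_le`, `norm_sub_ref_le`), and the
thermal part is small by `relEnergyThermo_small_near_diag` once the state temperature `ϑ(ρ, E)` is
shown to be close to `Θ = ϑ(r, r e(r,Θ))`: the temperature inversion is continuous on the open quadrant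
(`continuousOn_temperature`), hence uniformly continuous on a compact neighbourhood of the compact set
`{(r, r e(r,Θ)) : (r,Θ) ∈ K}`.

No named fact is invoked.
-/

noncomputable section

namespace Summit.AtomisticToContinuum.HydrodynamicLimit.Theorems.ChaosClosesEulerShellInit

open Set Metric Literature.Analysis.FluidPDE Literature.Analysis.FluidPDE.CompressibleEuler
  Literature.Analysis.FluidPDE.CompressibleEuler.StrongPointData
  Literature.Analysis.FluidPDE.CompressibleEuler.EulerPhase
  Literature.Analysis.FluidPDE.CompressibleEuler.EulerEOS
open Summit.AtomisticToContinuum.HydrodynamicLimit.Theorems.ChaosClosesEulerShell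

variable {eos : EulerEOS}

/-- Data bounded by `M` have velocity of norm `≤ 3|M|`. [folklore] -/
theorem norm_U_le_of_bounded {d : StrongPointData} {M : ℝ} (hB : d.Bounded M) :
    ‖d.U‖ ≤ 3 * |M| := by
  have hUi := hB.2.2.1
  have hb : ∀ i, d.U i ^ 2 ≤ |M| ^ 2 := fun i => by
    have h := abs_le.1 ((hUi i).trans (le_abs_self M))
    exact sq_le_sq' h.1 h.2
  have hsq : ‖d.U‖ ^ 2 ≤ (3 * |M|) ^ 2 := by
    rw [EuclideanSpace.real_norm_sq_eq, Fin.sum_univ_three]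
    nlinarith [hb 0, hb 1, hb 2, sq_nonneg |M|]
  exact (pow_le_pow_iff_left₀ (norm_nonneg _) (by positivity) two_ne_zero).1 hsq

/-- **The clamped relative energy is small near the data.** For `κ > 0` there is `η > 0` (depending
only on the equation of state, `K`, `M`, `δK`, `κ`) such that a state whose density, momentum and total
energy are `η`-close to those of a reference state `(r, Θ, U)` with `(r, Θ) ∈ K` and `|U_i| ≤ M` has
`ρ, E > 0` and `ℰ_Z ≤ κ`, the entropy clamp `Z = clamp a b` being inactive on the `δK`-box.
[cite: BrezinaFeireisl2018, (3.3)] -/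
theorem relEnergyZ_small_near_data (hG : eos.IsGibbs) (hS : eos.IsThermodynamicallyStable)
    (htemp : ∀ r E : ℝ, 0 < r → 0 < E → 0 < eos.temperature r E ∧ r * eos.e r (eos.temperature r E) = E)
    (hepos : ∀ r θ : ℝ, 0 < r → 0 < θ → 0 < eos.e r θ) {K : Set (ℝ × ℝ)} (hK : IsCompact K)
    (hKq : K ⊆ Ioi 0 ×ˢ Ioi 0) (M : ℝ) {a b δK : ℝ} (hδK : 0 < δK)
    (hsK : ∀ r Θ ρ ϑ : ℝ, (r, Θ) ∈ K → |ρ - r| ≤ δK → |ϑ - Θ| ≤ δK → a ≤ eos.s ρ ϑ ∧ eos.s ρ ϑ ≤ b)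
    {κ : ℝ} (hκ : 0 < κ) :
    ∃ η : ℝ, 0 < η ∧ ∀ d : StrongPointData, (d.r, d.Θ) ∈ K → d.Bounded M →
      ∀ (ρ E : ℝ) (m : EuclideanSpace ℝ (Fin 3)), |ρ - d.r| ≤ η → ‖m - d.r • d.U‖ ≤ η →
        |(‖m‖ ^ 2 / (2 * ρ) + E) - (d.r * ‖d.U‖ ^ 2 / 2 + d.r * eos.e d.r d.Θ)| ≤ η →
        0 < ρ ∧ 0 < E ∧ d.relEnergyZ eos (clamp a b) (ρ, E, m) ≤ κ := by
  have hKpos : ∀ z ∈ K, 0 < z.1 ∧ 0 < z.2 := fun z hz => hKq hz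
  -- (1) a positive lower bound of the reference density over `K`
  obtain ⟨rmin, hrmin, hrminle⟩ : ∃ rmin : ℝ, 0 < rmin ∧ ∀ z ∈ K, rmin ≤ z.1 :=
    hK.exists_forall_le' continuousOn_fst fun z hz => (hKpos z hz).1
  -- (2) the compact set `K'` of the reference points `(r, r e(r,Θ))` of the `(ρ, E)`-quadrant
  have he : ContinuousOn (fun z : ℝ × ℝ => eos.e z.1 z.2) (Ioi 0 ×ˢ Ioi 0) := hG.2.1.continuousOn
  set K' : Set (ℝ × ℝ) := (fun z : ℝ × ℝ => (z.1, z.1 * eos.e z.1 z.2)) '' K with hK'def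
  have hK'c : IsCompact K' :=
    hK.image_of_continuousOn ((continuousOn_fst.prodMk (continuousOn_fst.mul he)).mono hKq)
  have hK'q : K' ⊆ Ioi 0 ×ˢ Ioi 0 := by
    rintro _ ⟨z, hz, rfl⟩
    exact ⟨(hKpos z hz).1, mul_pos (hKpos z hz).1 (hepos _ _ (hKpos z hz).1 (hKpos z hz).2)⟩
  obtain ⟨δ₁, hδ₁, hδ₁q⟩ := hK'c.exists_cthickening_subset_open isOpen_quadrant hK'q
  have hSc : IsCompact (cthickening δ₁ K') := hK'c.cthickening
  -- (3) the thermal threshold and the uniform continuity of the temperature inversion near `K'`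
  obtain ⟨ηth, hηth, hηth'⟩ := relEnergyThermo_small_near_diag hG hK hKq (half_pos hκ)
  have huc := hSc.uniformContinuousOn_of_continuous ((continuousOn_temperature hG hS htemp).mono hδ₁q)
  rw [Metric.uniformContinuousOn_iff_le] at huc
  obtain ⟨η₂, hη₂, hη₂'⟩ := huc (min δK ηth) (lt_min hδK hηth)
  -- (4) constants: `‖U‖ ≤ P`, and the Lipschitz-type constant `L` of the internal energy
  obtain ⟨P, hP⟩ : ∃ P : ℝ, P = 3 * |M| := ⟨_, rfl⟩
  have hP0 : 0 ≤ P := by rw [hP]; positivity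
  have hUP : ∀ d : StrongPointData, d.Bounded M → ‖d.U‖ ≤ P := fun d hB =>
    hP ▸ norm_U_le_of_bounded hB
  obtain ⟨L, hL⟩ : ∃ L : ℝ, L = 1 + ((1 + P) ^ 2 / rmin + (1 + P) * P + P ^ 2 / 2) := ⟨_, rfl⟩
  have hL1 : 1 ≤ L := by
    have : 0 ≤ (1 + P) ^ 2 / rmin + (1 + P) * P + P ^ 2 / 2 := by positivity
    linarith
  have hL0 : 0 < L := by linarith
  -- (5) the threshold
  obtain ⟨η, hηdef⟩ : ∃ η : ℝ, η = min (min (min 1 (rmin / 2)) (min (δ₁ / L) (η₂ / L)))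
      (min (min δK ηth) (κ * rmin / (2 * (1 + P) ^ 2))) := ⟨_, rfl⟩
  have hη : 0 < η := by rw [hηdef]; positivity
  have hη1 : η ≤ 1 := by
    rw [hηdef]; exact (min_le_left _ _).trans ((min_le_left _ _).trans (min_le_left _ _))
  have hηr : η ≤ rmin / 2 := by
    rw [hηdef]; exact (min_le_left _ _).trans ((min_le_left _ _).trans (min_le_right _ _))
  have hηδ₁ : η * L ≤ δ₁ := by
    rw [← le_div_iff₀ hL0, hηdef]
    exact (min_le_left _ _).trans ((min_le_right _ _).trans (min_le_left _ _))
  have hηη₂ : η * L ≤ η₂ := by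
    rw [← le_div_iff₀ hL0, hηdef]
    exact (min_le_left _ _).trans ((min_le_right _ _).trans (min_le_right _ _))
  have hηδK : η ≤ δK := by
    rw [hηdef]; exact (min_le_right _ _).trans ((min_le_left _ _).trans (min_le_left _ _))
  have hηth_le : η ≤ ηth := by
    rw [hηdef]; exact (min_le_right _ _).trans ((min_le_left _ _).trans (min_le_right _ _))
  have hηκ : η * (2 * (1 + P) ^ 2) ≤ κ * rmin := by
    rw [← le_div_iff₀ (by positivity), hηdef]
    exact (min_le_right _ _).trans (min_le_right _ _)
  refine ⟨η, hη, fun d hdK hB ρ E m hρr hm hEt => ?_⟩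
  -- the reference state
  have hr : 0 < d.r := (hKpos _ hdK).1
  have hΘ : 0 < d.Θ := (hKpos _ hdK).2
  have hrd : rmin ≤ d.r := hrminle (d.r, d.Θ) hdK
  have hU : ‖d.U‖ ≤ P := hUP d hB
  -- `ρ ≥ rmin / 2 > 0`
  have hρr' := abs_le.1 hρr
  have hρlow : rmin / 2 ≤ ρ := by linarith [hρr'.1]
  have hρ : 0 < ρ := by linarith
  -- `‖m − ρU‖ ≤ η (1 + P)`
  have hw : ‖m - ρ • d.U‖ ≤ η * (1 + P) := by
    have h1 := norm_sub_ref_le m d.U d.r ρ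
    rw [abs_sub_comm] at h1
    have h2 : |ρ - d.r| * ‖d.U‖ ≤ η * P := mul_le_mul hρr hU (norm_nonneg _) hη.le
    calc ‖m - ρ • d.U‖ ≤ ‖m - d.r • d.U‖ + |ρ - d.r| * ‖d.U‖ := h1
      _ ≤ η + η * P := add_le_add hm h2
      _ = η * (1 + P) := by ring
  have hw2 : ‖m - ρ • d.U‖ ^ 2 ≤ η * (1 + P) ^ 2 := by
    have h1 : ‖m - ρ • d.U‖ ^ 2 ≤ (η * (1 + P)) ^ 2 := pow_le_pow_left₀ (norm_nonneg _) hw 2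
    have hηη : η * η ≤ η := by nlinarith
    have h2 : (η * (1 + P)) ^ 2 ≤ η * (1 + P) ^ 2 :=
      calc (η * (1 + P)) ^ 2 = (η * η) * (1 + P) ^ 2 := by ring
        _ ≤ η * (1 + P) ^ 2 := mul_le_mul_of_nonneg_right hηη (sq_nonneg _)
    exact h1.trans h2
  -- the kinetic part of the relative energy
  have hk1 : ‖m - ρ • d.U‖ ^ 2 / (2 * ρ) ≤ η * (1 + P) ^ 2 / rmin := by
    rw [div_le_div_iff₀ (by positivity) hrmin]
    calc ‖m - ρ • d.U‖ ^ 2 * rmin ≤ η * (1 + P) ^ 2 * rmin :=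
          mul_le_mul_of_nonneg_right hw2 hrmin.le
      _ ≤ η * (1 + P) ^ 2 * (2 * ρ) := mul_le_mul_of_nonneg_left (by linarith) (by positivity)
  -- the kinetic energy is close to that of the data
  have hkin : |‖m‖ ^ 2 / (2 * ρ) - d.r * ‖d.U‖ ^ 2 / 2| ≤
      η * ((1 + P) ^ 2 / rmin + (1 + P) * P + P ^ 2 / 2) := by
    have h1 := abs_kinetic_sub_le m d.U hρ
    have hk2 : ‖m - ρ • d.U‖ * ‖d.U‖ ≤ η * (1 + P) * P :=
      mul_le_mul hw hU (norm_nonneg _) (by positivity)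
    have hk3 : |(ρ - d.r) * ‖d.U‖ ^ 2 / 2| ≤ η * P ^ 2 / 2 := by
      have hU2 : ‖d.U‖ ^ 2 ≤ P ^ 2 := pow_le_pow_left₀ (norm_nonneg _) hU 2
      have e1 : |(ρ - d.r) * ‖d.U‖ ^ 2 / 2| = |ρ - d.r| * ‖d.U‖ ^ 2 / 2 := by
        rw [abs_div, abs_mul, abs_of_nonneg (sq_nonneg ‖d.U‖), abs_two]
      rw [e1]
      have := mul_le_mul hρr hU2 (sq_nonneg _) hη.le
      linarith
    have e : ‖m‖ ^ 2 / (2 * ρ) - d.r * ‖d.U‖ ^ 2 / 2 =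
        (‖m‖ ^ 2 / (2 * ρ) - ρ * ‖d.U‖ ^ 2 / 2) + (ρ - d.r) * ‖d.U‖ ^ 2 / 2 := by ring
    rw [e]
    calc |‖m‖ ^ 2 / (2 * ρ) - ρ * ‖d.U‖ ^ 2 / 2 + (ρ - d.r) * ‖d.U‖ ^ 2 / 2|
        ≤ |‖m‖ ^ 2 / (2 * ρ) - ρ * ‖d.U‖ ^ 2 / 2| + |(ρ - d.r) * ‖d.U‖ ^ 2 / 2| := abs_add_le _ _
      _ ≤ (η * (1 + P) ^ 2 / rmin + η * (1 + P) * P) + η * P ^ 2 / 2 :=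
          add_le_add (h1.trans (add_le_add hk1 hk2)) hk3
      _ = η * ((1 + P) ^ 2 / rmin + (1 + P) * P + P ^ 2 / 2) := by ring
  -- hence the internal energy is close to `r e(r,Θ)`
  have hEre : |E - d.r * eos.e d.r d.Θ| ≤ η * L := by
    have e : E - d.r * eos.e d.r d.Θ =
        ((‖m‖ ^ 2 / (2 * ρ) + E) - (d.r * ‖d.U‖ ^ 2 / 2 + d.r * eos.e d.r d.Θ)) -
          (‖m‖ ^ 2 / (2 * ρ) - d.r * ‖d.U‖ ^ 2 / 2) := by ring
    rw [e, hL]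
    calc |((‖m‖ ^ 2 / (2 * ρ) + E) - (d.r * ‖d.U‖ ^ 2 / 2 + d.r * eos.e d.r d.Θ)) -
          (‖m‖ ^ 2 / (2 * ρ) - d.r * ‖d.U‖ ^ 2 / 2)|
        ≤ |(‖m‖ ^ 2 / (2 * ρ) + E) - (d.r * ‖d.U‖ ^ 2 / 2 + d.r * eos.e d.r d.Θ)| +
          |‖m‖ ^ 2 / (2 * ρ) - d.r * ‖d.U‖ ^ 2 / 2| := abs_sub _ _
      _ ≤ η + η * ((1 + P) ^ 2 / rmin + (1 + P) * P + P ^ 2 / 2) := add_le_add hEt hkin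
      _ = η * (1 + ((1 + P) ^ 2 / rmin + (1 + P) * P + P ^ 2 / 2)) := by ring
  -- `(ρ, E)` lies in the compact neighbourhood of `K'`, inside the quadrant
  have hρL : |ρ - d.r| ≤ η * L := hρr.trans (le_mul_of_one_le_right hη.le hL1)
  have hxK' : (d.r, d.r * eos.e d.r d.Θ) ∈ K' := ⟨(d.r, d.Θ), hdK, rfl⟩
  have hy : (ρ, E) ∈ cthickening δ₁ K' :=
    mem_cthickening_of_abs_le hxK' (hρL.trans hηδ₁) (hEre.trans hηδ₁)
  have hE : 0 < E := (hδ₁q hy).2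
  -- the state temperature is close to `Θ = ϑ(r, r e(r,Θ))`
  have hϑ : |stateTemp eos ρ E - d.Θ| ≤ min δK ηth := by
    have hd : dist (d.r, d.r * eos.e d.r d.Θ) (ρ, E) ≤ η₂ := by
      rw [Prod.dist_eq, Real.dist_eq, Real.dist_eq, abs_sub_comm d.r ρ,
        abs_sub_comm (d.r * eos.e d.r d.Θ) E]
      exact max_le (hρL.trans hηη₂) (hEre.trans hηη₂)
    have h := hη₂' _ (self_subset_cthickening _ hxK') _ hy hd
    dsimp only at h
    rw [eos.temperature_energy d.r d.Θ hr hΘ, Real.dist_eq, abs_sub_comm] at h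
    exact h
  have hϑδK : |stateTemp eos ρ E - d.Θ| ≤ δK := hϑ.trans (min_le_left _ _)
  have hϑth : |stateTemp eos ρ E - d.Θ| ≤ ηth := hϑ.trans (min_le_right _ _)
  refine ⟨hρ, hE, ?_⟩
  -- on the quadrant, with the clamp inactive, `ℰ_Z = ½|m − ρU|²/ρ + R(ρ,ϑ | r,Θ)`
  have hsab := hsK d.r d.Θ ρ (stateTemp eos ρ E) hdK (hρr.trans hηδK) hϑδK
  have hinv : ρ * eos.e ρ (stateTemp eos ρ E) = E := (htemp ρ E hρ hE).2
  rw [relEnergyZ_eq (clamp a b) d hr.ne' (w := (ρ, E, m)) hρ hinv]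
  simp only [dens_mk, ien_mk, mom_mk, clamp_eq_self hsab.1 hsab.2, sub_self, mul_zero, add_zero]
  unfold relEnergyFull
  rw [← norm_sub_smul_sq m d.U ρ]
  have hkinZ : ‖m - ρ • d.U‖ ^ 2 / (2 * ρ) ≤ κ / 2 := by
    refine hk1.trans ?_
    rw [div_le_iff₀ hrmin]
    linarith
  have hthZ : eos.relEnergyThermo d.r d.Θ ρ (stateTemp eos ρ E) ≤ κ / 2 :=
    hηth' d.r d.Θ ρ (stateTemp eos ρ E) hdK (hρr.trans hηth_le) hϑth
  linarith

/-- REGISTERED SUB-GOAL `stub_bf18ShellInit` of the line `Sketch` (helper of `stub_bf18Shell`): the clamped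
relative energy of a state is small, and the state lies in the open quadrant, as soon as its density,
momentum and total energy are uniformly close to those of the (compactly ranged, bounded) data.
[cite: BrezinaFeireisl2018, (3.3)] -/
theorem stub_bf18ShellInit : ∀ (eos : EulerEOS), eos.IsGibbs → eos.IsThermodynamicallyStable → (∀ r E : ℝ, 0 < r → 0 < E → 0 < eos.temperature r E ∧ r * eos.e r (eos.temperature r E) = E) → (∀ r θ : ℝ, 0 < r → 0 < θ → 0 < eos.e r θ) → ∀ (K : Set (ℝ × ℝ)), IsCompact K → K ⊆ Set.Ioi 0 ×ˢ Set.Ioi 0 → ∀ (M a b δK : ℝ), 0 < δK → (∀ r Θ ρ ϑ : ℝ, (r, Θ) ∈ K → |ρ - r| ≤ δK → |ϑ - Θ| ≤ δK → a ≤ eos.s ρ ϑ ∧ eos.s ρ ϑ ≤ b) → ∀ κ : ℝ, 0 < κ → ∃ η : ℝ, 0 < η ∧ ∀ d : StrongPointData, (d.r, d.Θ) ∈ K → d.Bounded M → ∀ (ρ E : ℝ) (m : EuclideanSpace ℝ (Fin 3)), |ρ - d.r| ≤ η → ‖m - d.r • d.U‖ ≤ η → |(‖m‖ ^ 2 / (2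 * ρ) + E) - (d.r * ‖d.U‖ ^ 2 / 2 + d.r * eos.e d.r d.Θ)| ≤ η → 0 < ρ ∧ 0 < E ∧ d.relEnergyZ eos (clamp a b) (ρ, E, m) ≤ κ :=
  fun _eos hG hS htemp hepos _K hK hKq M _a _b _δK hδK hsK _κ hκ =>
    relEnergyZ_small_near_data hG hS htemp hepos hK hKq M hδK hsK hκ

end Summit.AtomisticToContinuum.HydrodynamicLimit.Theorems.ChaosClosesEulerShellInit

end
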